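import Summits.Ventures.HSemireg.WedgeHankelRecurrenceGaussTraceRearrangement

/-!
# Venture HSemireg — **THE SYMMETRIC JACOBI MATRIX IS ORTHOGONALLY DIAGONALISED BY THE GAUSS NODES** (Golub–Welsch form): for a positive recurrence with `q_{m+1} = ∏ (X − z_k)`, the SYMMETRIC
# Jacobi matrix `J^s` (diagonal `a_i`, off-diagonals `√b_i`) satisfies `diag(√h) J^s = J diag(√h)` (`h_j = b_1⋯b_j`, `J` the monic Jacobi matrix of N293), hence with `U = (q_j(z_k))` and the
# weights `μ` of N299 the matrix **`Q = diag(1∕√h) U diag(√μ)` is ORTHOGONAL, `J^s Q = Q diag(z)` and `Q_{0k}² = μ_k` (GOLUB–WELSCH: the weights are the squared first eigenvector components)**; **`tr(J^s J'^s) = Σ_{k,l} (QᵀQ')_{kl}² z_k z'_l`** for two such problems of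
# the same size, while entrywise **`tr(J^s J'^s) = Σ_i a_i a'_i + 2 Σ_{i<m} √b_{i+1} √b'_{i+1}`**

HONEST FRAMING. Part of the Lean index of the computation cell `pub-hsemireg` (seat p10 gen 47, Sunday typer «UNIFORM-IN-n»).  Real square matrices (products, transposes, traces), `Real.sqrt` and
finite sums only; no variety, no cohomology theory, no sheaf, no Ext group and no semiregularity map is constructed here; nothing here says that HC / HC_CM / HC_AV holds; no Literature fact
(unproved `Prop`) is declared or used.  Custodian versions as in `WedgeHankelSiegelIdeal` (1/3).
SOURCES (cited).  G. H. Golub, J. H. Welsch, *Calculation of Gauss quadrature rules*, Math. Comp. 23 (1969) 221–230, §2 (`J^s = Q Λ Qᵀ`, `Q` orthogonal); W. Gautschi, *Orthogonal Polynomials: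
Computation and Approximation* (2004), Thm 1.31, §3.1.1; J. H. Wilkinson, *The Algebraic Eigenvalue Problem* (1965), Ch. 1 §§ 47–48, Ch. 2 § 48 (`tr(AB)` for symmetric `A, B` via eigenvectors);
B. N. Parlett, *The Symmetric Eigenvalue Problem* (1980), §7.1 (symmetrisation of a positive tridiagonal matrix).
PROOF TYPED HERE.  `√h_{i+1} = √h_i √b_{i+1}` (N-`Finset.prod_Ico_succ_top`, `Real.sqrt_mul`) gives `diag(√h) J^s = J diag(√h)` entrywise; then N299 `evalMatrix_mul_weights_mul_transpose`
(`U diag(μ) Uᵀ = diag(h)`) and N299 `jacobi_mul_evalMatrix` (`J U = U diag(z)`) give `Q Qᵀ = 1`, `Qᵀ Q = 1` (`mul_eq_one_comm`), `J^s Q = Q diag(z)`; `tr(J^s J'^s) = tr(D M D' Mᵀ)`, `M = QᵀQ'`,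
by `Matrix.trace_mul_comm`; the entrywise trace by the bookkeeping of N298 `trace_jacobi_sq` with `√b √b'` in place of `1 · b`.
DEDUP DISCLOSURE (`rg -n -i 'symmJacobi|orthogonal|sqrt \(b' Summits/Ventures/HSemireg/WedgeHankelRecurrenceGauss*`, 2026-09-04): N299 ∕ N1065 diagonalise the MONIC (non-symmetric) `J` as `U D U⁻¹`;
the symmetric form, the orthogonal `Q`, the weights-as-first-components statement and the two-matrix trace identities are new; 0 hits for the 6 names below.

WHAT IS IN THE TREE.  N299-block `jacobi_mul_evalMatrix`, `evalMatrix_mul_weights_mul_transpose` (file `WedgeHankelRecurrenceGaussJacobiDiagonalization`); N298 `trace_jacobi_sq` (pattern);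
Mathlib `Matrix.diagonal_mul`, `Matrix.mul_diagonal`, `Matrix.diagonal_mul_diagonal`, `Matrix.diagonal_transpose`, `Matrix.trace_mul_comm`, `mul_eq_one_comm`, `Real.sqrt_mul`,
`Real.mul_self_sqrt`, `Real.div_sqrt`.
THIS FILE (namespace `Summit.Ventures.HSemireg.Wedge.HankelOuter` continued; CHAINED on N415 (import only); 0 definitions — `J^s`, `Q` given by hypotheses ∕ inline):
* §1181 `sqrt_normProd_succ` (`√h_{i+1} = √h_i √b_{i+1}`, `h_i > 0`), `diagonal_sqrt_mul_symmJacobi` (`diag(√h) J^s = J diag(√h)`), **`golubWelsch_explicit`** (`Q = diag(1∕√h) U diag(√μ)`: `Q Qᵀ = 1`,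
  `Qᵀ Q = 1`, `J^s Q = Q diag(z)`, **`Q_{0k}² = μ_k`**, `Σ μ_k = 1`), **`symmJacobi_orthogonal_eigen`** (`∃ Q`), **`trace_symmJacobi_mul_eq_sum_sq`** (`tr(J^s J'^s) = Σ_{k,l} (QᵀQ')_{kl}² z_k z'_l`), **`trace_symmJacobi_mul`** (`= Σ a_i a'_i + 2 Σ √b_{i+1} √b'_{i+1}`).
CAVEATS.  `b > 0` throughout (square roots of the couplings); `z` any strictly increasing enumeration of the zeros.  Nothing Ext-side.  New names only.
-/

open Module Polynomial
open scoped Matrix Polynomial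

namespace Summit.Ventures.HSemireg.Wedge.HankelOuter

/-! ## §1181. The symmetric Jacobi matrix and its orthogonal eigenvector matrix -/

/-- `h_j = b_1⋯b_j > 0` and **`√h_{i+1} = √h_i · √b_{i+1}`**. [bookkeeping; this file, §1181] -/
theorem sqrt_normProd_succ {b : ℕ → ℝ} (hb : ∀ j, 0 < b j) (i : ℕ) :
    0 < ∏ l ∈ Finset.Ico 1 (i + 1), b l ∧ Real.sqrt (∏ l ∈ Finset.Ico 1 (i + 1 + 1), b l) = Real.sqrt (∏ l ∈ Finset.Ico 1 (i + 1), b l) * Real.sqrt (b (i + 1)) := by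
  have hpos : 0 < ∏ l ∈ Finset.Ico 1 (i + 1), b l := Finset.prod_pos fun l _ => hb l
  refine ⟨hpos, ?_⟩
  rw [Finset.prod_Ico_succ_top (by omega : 1 ≤ i + 1), Real.sqrt_mul hpos.le]

/-- **`diag(√h) · J^s = J · diag(√h)`**: the symmetric Jacobi matrix (off-diagonals `√b`) is diagonally similar to the monic one (super-diagonal `1`, sub-diagonal `b`). [Parlett §7.1; Gautschi
Thm 1.31; this file, §1181] -/
theorem diagonal_sqrt_mul_symmJacobi {a b : ℕ → ℝ} (hb : ∀ j, 0 < b j) {m : ℕ} {J Js : Matrix (Fin (m + 1)) (Fin (m + 1)) ℝ}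
    (hJ : ∀ i j : Fin (m + 1), J i j = if (i : ℕ) = j then a i else if (j : ℕ) = i + 1 then 1 else if (i : ℕ) = j + 1 then b i else 0)
    (hJs : ∀ i j : Fin (m + 1), Js i j = if (i : ℕ) = j then a i else if (j : ℕ) = i + 1 then Real.sqrt (b j) else if (i : ℕ) = j + 1 then Real.sqrt (b i) else 0) :
    Matrix.diagonal (fun j : Fin (m + 1) => Real.sqrt (∏ l ∈ Finset.Ico 1 ((j : ℕ) + 1), b l)) * Js =
      J * Matrix.diagonal (fun j : Fin (m + 1) => Real.sqrt (∏ l ∈ Finset.Ico 1 ((j : ℕ) + 1), b l)) := by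
  ext i j
  rw [Matrix.diagonal_mul, Matrix.mul_diagonal, hJ, hJs]
  by_cases h1 : (i : ℕ) = j
  · rw [if_pos h1, if_pos h1, Fin.ext h1]; ring
  rw [if_neg h1, if_neg h1]
  by_cases h2 : (j : ℕ) = i + 1
  · rw [if_pos h2, if_pos h2, one_mul, h2, (sqrt_normProd_succ hb i).2]
  rw [if_neg h2, if_neg h2]
  by_cases h3 : (i : ℕ) = j + 1
  · rw [if_pos h3, if_pos h3, h3, (sqrt_normProd_succ hb j).2]
    have hs := Real.sqrt_nonneg (b ((j : ℕ) + 1))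
    have hbb : Real.sqrt (b ((j : ℕ) + 1)) * Real.sqrt (b ((j : ℕ) + 1)) = b ((j : ℕ) + 1) := Real.mul_self_sqrt (hb _).le
    linear_combination (Real.sqrt (∏ l ∈ Finset.Ico 1 ((j : ℕ) + 1), b l)) * hbb
  · rw [if_neg h3, if_neg h3, mul_zero, zero_mul]

/-- **GOLUB–WELSCH, EXPLICIT FORM: for Favard weights `μ > 0` with `U diag(μ) Uᵀ = diag(h)` (`U = (q_j(z_k))`, N299), the matrix `Q = diag(1∕√h) U diag(√μ)` is ORTHOGONAL,
`J^s Q = Q diag(z)`, its first row is `(√μ_k)_k` — so THE WEIGHTS ARE THE SQUARED FIRST COMPONENTS OF THE NORMALISED EIGENVECTORS, `Q_{0k}² = μ_k` — and `Σ_k μ_k = 1`.**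
[Golub–Welsch 1969 §2, eq. (2.8); Gautschi Thm 1.31 ∕ Thm 3.1; Wilf 1962; this file, §1181] -/
theorem golubWelsch_explicit {q : ℕ → ℝ[X]} {a b : ℕ → ℝ} (hq0 : q 0 = 1) (hq1 : q 1 = Polynomial.X - C (a 0))
    (hrec : ∀ n, q (n + 2) = (Polynomial.X - C (a (n + 1))) * q (n + 1) - C (b (n + 1)) * q n) (hb : ∀ j, 0 < b j) {m : ℕ} {Js : Matrix (Fin (m + 1)) (Fin (m + 1)) ℝ}
    (hJs : ∀ i j : Fin (m + 1), Js i j = if (i : ℕ) = j then a i else if (j : ℕ) = i + 1 then Real.sqrt (b j) else if (i : ℕ) = j + 1 then Real.sqrt (b i) else 0)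
    {z : Fin (m + 1) → ℝ} (hzq : q (m + 1) = ∏ k, (Polynomial.X - C (z k))) {μ : Fin (m + 1) → ℝ} (hμ : ∀ k, 0 < μ k)
    (hUU : Matrix.of (fun j k : Fin (m + 1) => (q j).eval (z k)) * Matrix.diagonal μ * (Matrix.of (fun j k : Fin (m + 1) => (q j).eval (z k)))ᵀ =
      Matrix.diagonal (fun j : Fin (m + 1) => ∏ l ∈ Finset.Ico 1 ((j : ℕ) + 1), b l)) :
    (Matrix.diagonal (fun j : Fin (m + 1) => (Real.sqrt (∏ l ∈ Finset.Ico 1 ((j : ℕ) + 1), b l))⁻¹) * Matrix.of (fun j k : Fin (m + 1) => (q j).eval (z k)) *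
        Matrix.diagonal (fun k => Real.sqrt (μ k))) *
      (Matrix.diagonal (fun j : Fin (m + 1) => (Real.sqrt (∏ l ∈ Finset.Ico 1 ((j : ℕ) + 1), b l))⁻¹) * Matrix.of (fun j k : Fin (m + 1) => (q j).eval (z k)) *
        Matrix.diagonal (fun k => Real.sqrt (μ k)))ᵀ = 1 ∧
    (Matrix.diagonal (fun j : Fin (m + 1) => (Real.sqrt (∏ l ∈ Finset.Ico 1 ((j : ℕ) + 1), b l))⁻¹) * Matrix.of (fun j k : Fin (m + 1) => (q j).eval (z k)) *
        Matrix.diagonal (fun k => Real.sqrt (μ k)))ᵀ *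
      (Matrix.diagonal (fun j : Fin (m + 1) => (Real.sqrt (∏ l ∈ Finset.Ico 1 ((j : ℕ) + 1), b l))⁻¹) * Matrix.of (fun j k : Fin (m + 1) => (q j).eval (z k)) *
        Matrix.diagonal (fun k => Real.sqrt (μ k))) = 1 ∧
    Js * (Matrix.diagonal (fun j : Fin (m + 1) => (Real.sqrt (∏ l ∈ Finset.Ico 1 ((j : ℕ) + 1), b l))⁻¹) * Matrix.of (fun j k : Fin (m + 1) => (q j).eval (z k)) *
        Matrix.diagonal (fun k => Real.sqrt (μ k))) =
      (Matrix.diagonal (fun j : Fin (m + 1) => (Real.sqrt (∏ l ∈ Finset.Ico 1 ((j : ℕ) + 1), b l))⁻¹) * Matrix.of (fun j k : Fin (m + 1) => (q j).eval (z k)) *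
        Matrix.diagonal (fun k => Real.sqrt (μ k))) * Matrix.diagonal z ∧
    (∀ k, (Matrix.diagonal (fun j : Fin (m + 1) => (Real.sqrt (∏ l ∈ Finset.Ico 1 ((j : ℕ) + 1), b l))⁻¹) * Matrix.of (fun j k : Fin (m + 1) => (q j).eval (z k)) *
        Matrix.diagonal (fun k => Real.sqrt (μ k))) 0 k ^ 2 = μ k) ∧ ∑ k, μ k = 1 := by
  -- the monic Jacobi matrix and the chapter's diagonalisation data
  set J : Matrix (Fin (m + 1)) (Fin (m + 1)) ℝ := Matrix.of fun i j : Fin (m + 1) => if (i : ℕ) = j then a i else if (j : ℕ) = i + 1 then 1 else if (i : ℕ) = j + 1 then b i else 0 with hJdef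
  have hJ : ∀ i j : Fin (m + 1), J i j = if (i : ℕ) = j then a i else if (j : ℕ) = i + 1 then 1 else if (i : ℕ) = j + 1 then b i else 0 := fun i j => by rw [hJdef, Matrix.of_apply]
  have hzr : ∀ k, (q (m + 1)).eval (z k) = 0 := fun k => by rw [hzq, eval_prod]; exact Finset.prod_eq_zero (Finset.mem_univ k) (by simp)
  have hJU := jacobi_mul_evalMatrix hq0 hq1 hrec hJ hzr
  set U : Matrix (Fin (m + 1)) (Fin (m + 1)) ℝ := Matrix.of (fun j k : Fin (m + 1) => (q j).eval (z k)) with hU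
  set s : Fin (m + 1) → ℝ := fun j => Real.sqrt (∏ l ∈ Finset.Ico 1 ((j : ℕ) + 1), b l) with hs
  have hspos : ∀ j, 0 < s j := fun j => Real.sqrt_pos.2 (sqrt_normProd_succ hb j).1
  have hss : ∀ j, s j * s j = ∏ l ∈ Finset.Ico 1 ((j : ℕ) + 1), b l := fun j => Real.mul_self_sqrt (sqrt_normProd_succ hb j).1.le
  have hSJ : Matrix.diagonal s * Js = J * Matrix.diagonal s := diagonal_sqrt_mul_symmJacobi hb hJ hJs
  -- `Q Qᵀ = diag(s⁻¹) (U diag μ Uᵀ) diag(s⁻¹) = 1`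
  have hQQ : Matrix.diagonal (fun j => (s j)⁻¹) * U * Matrix.diagonal (fun k => Real.sqrt (μ k)) * (Matrix.diagonal (fun j => (s j)⁻¹) * U * Matrix.diagonal (fun k => Real.sqrt (μ k)))ᵀ = 1 := by
    have h1 : Matrix.diagonal (fun j => (s j)⁻¹) * U * Matrix.diagonal (fun k => Real.sqrt (μ k)) * (Matrix.diagonal (fun j => (s j)⁻¹) * U * Matrix.diagonal (fun k => Real.sqrt (μ k)))ᵀ =
        Matrix.diagonal (fun j => (s j)⁻¹) * (U * Matrix.diagonal μ * Uᵀ) * Matrix.diagonal (fun j => (s j)⁻¹) := by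
      rw [Matrix.transpose_mul, Matrix.transpose_mul, Matrix.diagonal_transpose, Matrix.diagonal_transpose]
      simp only [Matrix.mul_assoc]
      congr 2
      rw [← Matrix.mul_assoc (Matrix.diagonal _), Matrix.diagonal_mul_diagonal]
      congr 2
      ext k
      exact Real.mul_self_sqrt (hμ k).le
    rw [h1, hUU]
    ext i j
    rw [Matrix.mul_diagonal, Matrix.diagonal_mul, Matrix.diagonal_apply, Matrix.one_apply]
    by_cases h : i = j
    · subst h; rw [if_pos rfl, if_pos rfl, ← hss]; field_simp [(hspos i).ne']
    · rw [if_neg h, if_neg h, mul_zero, zero_mul]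
  refine ⟨hQQ, mul_eq_one_comm.1 hQQ, ?_, fun k => ?_, ?_⟩
  · -- `Js Q = Q diag(z)`: `Js diag(s⁻¹) = diag(s⁻¹) J`, `J U = U diag z`, diagonals commute
    have hinv : Matrix.diagonal (fun j => (s j)⁻¹) * Matrix.diagonal s = 1 := by
      rw [Matrix.diagonal_mul_diagonal, ← Matrix.diagonal_one]; congr 1; ext j; exact inv_mul_cancel₀ (hspos j).ne'
    have hinv' : Matrix.diagonal s * Matrix.diagonal (fun j => (s j)⁻¹) = 1 := by
      rw [Matrix.diagonal_mul_diagonal, ← Matrix.diagonal_one]; congr 1; ext j; exact mul_inv_cancel₀ (hspos j).ne'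
    have hJsS : Js * Matrix.diagonal (fun j => (s j)⁻¹) = Matrix.diagonal (fun j => (s j)⁻¹) * J := by
      calc Js * Matrix.diagonal (fun j => (s j)⁻¹) = Matrix.diagonal (fun j => (s j)⁻¹) * (Matrix.diagonal s * Js) * Matrix.diagonal (fun j => (s j)⁻¹) := by
            rw [← Matrix.mul_assoc, hinv, Matrix.one_mul]
        _ = Matrix.diagonal (fun j => (s j)⁻¹) * J := by rw [hSJ, Matrix.mul_assoc, Matrix.mul_assoc, hinv', Matrix.mul_one]
    have hcomm : Matrix.diagonal (fun k => Real.sqrt (μ k)) * Matrix.diagonal z = Matrix.diagonal z * Matrix.diagonal (fun k => Real.sqrt (μ k)) := by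
      rw [Matrix.diagonal_mul_diagonal, Matrix.diagonal_mul_diagonal]; congr 1; ext k; ring
    calc Js * (Matrix.diagonal (fun j => (s j)⁻¹) * U * Matrix.diagonal (fun k => Real.sqrt (μ k)))
        = (Js * Matrix.diagonal (fun j => (s j)⁻¹)) * U * Matrix.diagonal (fun k => Real.sqrt (μ k)) := by simp only [Matrix.mul_assoc]
      _ = Matrix.diagonal (fun j => (s j)⁻¹) * (J * U) * Matrix.diagonal (fun k => Real.sqrt (μ k)) := by rw [hJsS]; simp only [Matrix.mul_assoc]
      _ = Matrix.diagonal (fun j => (s j)⁻¹) * U * Matrix.diagonal (fun k => Real.sqrt (μ k)) * Matrix.diagonal z := by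
          rw [hJU]; simp only [Matrix.mul_assoc]; rw [hcomm]
  · -- first row: `s_0 = 1`, `q_0 = 1`
    rw [Matrix.mul_diagonal, Matrix.diagonal_mul]
    simp only [hU, Matrix.of_apply, Fin.val_zero, zero_add, Finset.Ico_self, Finset.prod_empty, Real.sqrt_one, inv_one, one_mul, hq0, eval_one]
    exact Real.sq_sqrt (hμ k).le
  · -- `Σ μ_k = (U diag μ Uᵀ)_{00} = h_0 = 1`
    have h := congr_fun (congr_fun hUU 0) 0
    rw [Matrix.mul_apply, Matrix.diagonal_apply_eq, show ((0 : Fin (m + 1)) : ℕ) = 0 from rfl, zero_add, Finset.Ico_self, Finset.prod_empty] at h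
    rw [← h]
    refine Finset.sum_congr rfl fun k _ => ?_
    simp only [Matrix.mul_diagonal, hU, Matrix.of_apply, Matrix.transpose_apply, Fin.val_zero, hq0, eval_one]; ring

/-- **GOLUB–WELSCH: the symmetric Jacobi matrix has an ORTHOGONAL eigenvector matrix with the Gauss nodes as eigenvalues** — there is `Q` with `Q Qᵀ = 1`, `Qᵀ Q = 1`, `J^s Q = Q diag(z)`
(`Q = diag(1∕√h) U diag(√μ)`, `U = (q_j(z_k))`, `μ` the Favard weights of N299). [Golub–Welsch 1969 §2; Gautschi Thm 1.31; this file, §1181] -/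
theorem symmJacobi_orthogonal_eigen {q : ℕ → ℝ[X]} {a b : ℕ → ℝ} (hq0 : q 0 = 1) (hq1 : q 1 = Polynomial.X - C (a 0))
    (hrec : ∀ n, q (n + 2) = (Polynomial.X - C (a (n + 1))) * q (n + 1) - C (b (n + 1)) * q n) (hb : ∀ j, 0 < b j) {m : ℕ} {Js : Matrix (Fin (m + 1)) (Fin (m + 1)) ℝ}
    (hJs : ∀ i j : Fin (m + 1), Js i j = if (i : ℕ) = j then a i else if (j : ℕ) = i + 1 then Real.sqrt (b j) else if (i : ℕ) = j + 1 then Real.sqrt (b i) else 0)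
    {z : Fin (m + 1) → ℝ} (hz : StrictMono z) (hzq : q (m + 1) = ∏ k, (Polynomial.X - C (z k))) :
    ∃ Q : Matrix (Fin (m + 1)) (Fin (m + 1)) ℝ, Q * Qᵀ = 1 ∧ Qᵀ * Q = 1 ∧ Js * Q = Q * Matrix.diagonal z := by
  obtain ⟨μ, hμ, hUU⟩ := evalMatrix_mul_weights_mul_transpose hq0 hq1 hrec hb hz hzq
  obtain ⟨h1, h2, h3, -, -⟩ := golubWelsch_explicit hq0 hq1 hrec hb hJs hzq hμ hUU
  exact ⟨_, h1, h2, h3⟩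

/-- **`tr(J^s J'^s) = Σ_{k,l} (QᵀQ')_{kl}² z_k z'_l`** whenever `Q, Q'` are orthogonal with `J^s Q = Q diag(z)`, `J'^s Q' = Q' diag(z')`. [Wilkinson Ch. 2 §48; Hoffman–Wielandt 1953; this
file, §1181] -/
theorem trace_symmJacobi_mul_eq_sum_sq {m : ℕ} {Js Js' Q Q' : Matrix (Fin (m + 1)) (Fin (m + 1)) ℝ} {z z' : Fin (m + 1) → ℝ}
    (hQ : Q * Qᵀ = 1) (hQe : Js * Q = Q * Matrix.diagonal z) (hQ' : Q' * Q'ᵀ = 1) (hQ'e : Js' * Q' = Q' * Matrix.diagonal z') :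
    (Js * Js').trace = ∑ k, ∑ l, ((Qᵀ * Q') k l) ^ 2 * (z k * z' l) := by
  have hJs : Js = Q * Matrix.diagonal z * Qᵀ := by rw [← hQe, Matrix.mul_assoc, hQ, Matrix.mul_one]
  have hJs' : Js' = Q' * Matrix.diagonal z' * Q'ᵀ := by rw [← hQ'e, Matrix.mul_assoc, hQ', Matrix.mul_one]
  rw [hJs, hJs']
  -- cyclic permutation: `tr(Q D Qᵀ Q' D' Q'ᵀ) = tr(D (QᵀQ') D' (QᵀQ')ᵀ)`
  have hcyc : (Q * Matrix.diagonal z * Qᵀ * (Q' * Matrix.diagonal z' * Q'ᵀ)).trace =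
      (Matrix.diagonal z * (Qᵀ * Q') * Matrix.diagonal z' * (Qᵀ * Q')ᵀ).trace := by
    rw [Matrix.transpose_mul, Matrix.transpose_transpose]
    rw [show Q * Matrix.diagonal z * Qᵀ * (Q' * Matrix.diagonal z' * Q'ᵀ) = Q * (Matrix.diagonal z * (Qᵀ * Q') * Matrix.diagonal z' * Q'ᵀ) by simp only [Matrix.mul_assoc],
      Matrix.trace_mul_comm]
    simp only [Matrix.mul_assoc]
  rw [hcyc]
  unfold Matrix.trace
  refine Finset.sum_congr rfl fun k _ => ?_
  rw [Matrix.diag_apply, Matrix.mul_apply]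
  refine Finset.sum_congr rfl fun l _ => ?_
  rw [Matrix.transpose_apply, Matrix.mul_diagonal, Matrix.diagonal_mul]
  ring

/-- **Entrywise: `tr(J^s J'^s) = Σ_{i ≤ m} a_i a'_i + 2 Σ_{i<m} √b_{i+1} √b'_{i+1}`** for two symmetric Jacobi matrices of the same size. [Wilkinson Ch. 2 §48; this file, §1181] -/
theorem trace_symmJacobi_mul {a b a' b' : ℕ → ℝ} {m : ℕ} {Js Js' : Matrix (Fin (m + 1)) (Fin (m + 1)) ℝ}
    (hJs : ∀ i j : Fin (m + 1), Js i j = if (i : ℕ) = j then a i else if (j : ℕ) = i + 1 then Real.sqrt (b j) else if (i : ℕ) = j + 1 then Real.sqrt (b i) else 0)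
    (hJs' : ∀ i j : Fin (m + 1), Js' i j = if (i : ℕ) = j then a' i else if (j : ℕ) = i + 1 then Real.sqrt (b' j) else if (i : ℕ) = j + 1 then Real.sqrt (b' i) else 0) :
    (Js * Js').trace = ∑ i ∈ Finset.range (m + 1), a i * a' i + 2 * ∑ i ∈ Finset.range m, Real.sqrt (b (i + 1)) * Real.sqrt (b' (i + 1)) := by
  have hdiag : ∀ i : Fin (m + 1), (Js * Js') i i = a i * a' i + (if (i : ℕ) + 1 < m + 1 then Real.sqrt (b (i + 1)) * Real.sqrt (b' (i + 1)) else 0) +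
      (if 0 < (i : ℕ) then Real.sqrt (b i) * Real.sqrt (b' i) else 0) := by
    intro i
    have hi := i.isLt
    rw [Matrix.mul_apply]
    simp only [hJs, hJs']
    rw [Fin.sum_univ_eq_sum_range (fun j : ℕ => (if (i : ℕ) = j then a i else if j = (i : ℕ) + 1 then Real.sqrt (b j) else if (i : ℕ) = j + 1 then Real.sqrt (b i) else 0) *
      (if j = (i : ℕ) then a' j else if (i : ℕ) = j + 1 then Real.sqrt (b' i) else if j = (i : ℕ) + 1 then Real.sqrt (b' j) else 0)) (m + 1)]
    have hsplit : ∀ j : ℕ, (if (i : ℕ) = j then a i else if j = (i : ℕ) + 1 then Real.sqrt (b j) else if (i : ℕ) = j + 1 then Real.sqrt (b i) else 0) *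
        (if j = (i : ℕ) then a' j else if (i : ℕ) = j + 1 then Real.sqrt (b' i) else if j = (i : ℕ) + 1 then Real.sqrt (b' j) else 0) =
        (if j = i then a i * a' i else 0) + (if j = (i : ℕ) + 1 then Real.sqrt (b (i + 1)) * Real.sqrt (b' (i + 1)) else 0) +
          (if 0 < (i : ℕ) then (if j = (i : ℕ) - 1 then Real.sqrt (b i) * Real.sqrt (b' i) else 0) else 0) := fun j => by
      by_cases h1 : (i : ℕ) = j
      · rw [if_pos h1, if_pos h1.symm, if_pos h1.symm, if_neg (by omega : ¬ j = (i : ℕ) + 1), ← h1]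
        by_cases hp : 0 < (i : ℕ)
        · rw [if_pos hp, if_neg (by omega : ¬ (i : ℕ) = (i : ℕ) - 1)]; ring
        · rw [if_neg hp]; ring
      · rw [if_neg h1, if_neg (Ne.symm h1), if_neg (Ne.symm h1)]
        by_cases h2 : j = (i : ℕ) + 1
        · rw [if_pos h2, if_neg (by omega : ¬ (i : ℕ) = j + 1), if_pos h2, if_pos h2, h2]
          by_cases hp : 0 < (i : ℕ)
          · rw [if_pos hp, if_neg (by omega : ¬ (i : ℕ) + 1 = (i : ℕ) - 1)]; ring
          · rw [if_neg hp]; ring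
        · rw [if_neg h2, if_neg h2, if_neg h2]
          by_cases h3 : (i : ℕ) = j + 1
          · rw [if_pos h3, if_pos h3, if_pos (by omega : 0 < (i : ℕ)), if_pos (by omega : j = (i : ℕ) - 1), h3]; ring
          · rw [if_neg h3, if_neg h3]
            by_cases hp : 0 < (i : ℕ)
            · rw [if_pos hp, if_neg (by omega : ¬ j = (i : ℕ) - 1)]; ring
            · rw [if_neg hp]; ring
    simp only [hsplit]
    rw [Finset.sum_add_distrib, Finset.sum_add_distrib, Finset.sum_ite_eq' (Finset.range (m + 1)), Finset.sum_ite_eq' (Finset.range (m + 1)),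
      if_pos (Finset.mem_range.2 hi)]
    have h3 : ∑ j ∈ Finset.range (m + 1), (if 0 < (i : ℕ) then (if j = (i : ℕ) - 1 then Real.sqrt (b i) * Real.sqrt (b' i) else 0) else 0) =
        if 0 < (i : ℕ) then Real.sqrt (b i) * Real.sqrt (b' i) else 0 := by
      by_cases hp : 0 < (i : ℕ)
      · simp only [if_pos hp]
        rw [Finset.sum_ite_eq' (Finset.range (m + 1)), if_pos (Finset.mem_range.2 (by omega))]
      · simp only [if_neg hp, Finset.sum_const_zero]
    rw [h3]
    by_cases hlast : (i : ℕ) + 1 < m + 1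
    · rw [if_pos (Finset.mem_range.2 hlast), if_pos hlast]
    · rw [if_neg (fun h => hlast (Finset.mem_range.1 h)), if_neg hlast]
  unfold Matrix.trace
  simp only [Matrix.diag_apply, hdiag]
  rw [Fin.sum_univ_eq_sum_range (fun i : ℕ => a i * a' i + (if i + 1 < m + 1 then Real.sqrt (b (i + 1)) * Real.sqrt (b' (i + 1)) else 0) + (if 0 < i then Real.sqrt (b i) * Real.sqrt (b' i) else 0))
    (m + 1), Finset.sum_add_distrib, Finset.sum_add_distrib]
  have hA : ∑ i ∈ Finset.range (m + 1), (if i + 1 < m + 1 then Real.sqrt (b (i + 1)) * Real.sqrt (b' (i + 1)) else 0) = ∑ i ∈ Finset.range m, Real.sqrt (b (i + 1)) * Real.sqrt (b' (i + 1)) := by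
    rw [Finset.sum_range_succ, if_neg (lt_irrefl _), add_zero]
    exact Finset.sum_congr rfl fun i hi => if_pos (by have := Finset.mem_range.1 hi; omega)
  have hB : ∑ i ∈ Finset.range (m + 1), (if 0 < i then Real.sqrt (b i) * Real.sqrt (b' i) else 0) = ∑ i ∈ Finset.range m, Real.sqrt (b (i + 1)) * Real.sqrt (b' (i + 1)) := by
    rw [Finset.sum_range_succ', if_neg (lt_irrefl 0), add_zero]
    exact Finset.sum_congr rfl fun i _ => if_pos (Nat.succ_pos i)
  rw [hA, hB]
  ring

end Summit.Ventures.HSemireg.Wedge.HankelOuter
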